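import Summits.BirchSwinnertonDyer.BirchSwinnertonDyer.Theorems.SemiOrdinaryEisensteinDescentCasselsTateLemma615OfPoitouTateAt
import Literature.NumberTheory.GaloisRepresentations.NumberFieldCdTwoProofs
import HarnessLib

/-!
# The levelwise Cassels–Tate fact FOR THE INVARIANT MAPS from {I 4.10(a) cochain form, (v)} and Poitou–Tate AT `E[p^{M₀}]`:
# the `Ш³(K, μ_n) = 0` input is a THEOREM at the odd prime-power levels (Serre II §4.4 Prop. 13, in the tree) — route
# `SemiOrdinaryEisensteinDescent`, print debt `CasselsTateLevelInputsFact` (stmt-BirchSwinnertonDyer-20191, conjunct 1 of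
# `KolyvaginPrimitivesAtThree` stmt-25896); width seat `bsd-wall-soed-p2-w3` g4 (`--supports stmt-BirchSwinnertonDyer-25898`, helper)

HONEST FRAMING. THEOREMS ONLY (no definition, no named fact, no `sorry`, no instance). Nothing here proves a case of BSD. Part 3 of
the CT print-debt series (`…CasselsTateLemma615Bridge`, `…CasselsTateLemma615OfPoitouTateAt`). Of the FOUR displayed residual
inputs of `casselsTate_levelInputs_of_canonical_inputs` (w2 g2) for THE family `LocalInvariants.canonical K (m·m)` —
`hH3` (Milne I 4.10(c): `Ш³(K, μ_n) = 0`), `hPTc` (I 4.10(a), cochain form), `h615` (I Lemma 6.15), `hconj` ((v)) — part 2 discharged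
`h615` from Poitou–Tate AT `E[m]`; this part observes that `hH3` is only ever USED at the levels `n = p^{M₀}·p^{M₀}` with `p` ODD, where
the whole group `H³(K, μ_n)` vanishes for EVERY number field `K` by `cd_p(Γ_K) ≤ 2` (`p ≠ 2`) — Serre, *Cohomologie galoisienne* II §4.4
Prop. 13, a THEOREM of the tree (`fieldCdLE_two_of_numberField_holds`, `NumberFieldCdTwoProofs.lean`). Hence:

* `galoisCohomology_three_mu_eq_zero_of_ne_two` — `H³(K, μ_{p^r}) = 0` for `p ≠ 2`, every number field `K` (every class is `0`);
* `casselsTate_levelInputs_of_hPTc_of_hconj_of_selmerComplementAt` — **`casselsTate_levelInputs K` (item 20191's body at `K`) from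
  `hPTc` + `hconj` + Poitou–Tate AT the modules `E[p^{M₀}]` (Howard (i) for THE maps at level `p^{M₀}`) ONLY** — w2 g2's assembly
  re-run with `hH3` supplied by the theorem above and `h615` by part 2;
* `casselsTate_levelInputs_of_hPTc_of_hconj_of_middleExactAt` — the same with the per-module input in Milne I 4.10(b) shape
  (`Ker γ¹ ⊆ Im β¹` for `E[p^{M₀}]`, THE maps, all admissible `S ⊇ ∞`) — the shape the Poitou–Tate lanes deliver.

So the CT residual for THE maps is {`hPTc`, `hconj`} ⊕ the per-module PT input shared with the route's item 23092.
References: [SerreGaloisCohomology1997] II §4.4 Prop. 13; [MilneADT2006] I Cor. 2.3, Thm. 4.10, §6 Prop. 6.9, Thm. 6.13, Lemma 6.15;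
[Howard2004HeegnerKolyvagin] Thm. 2.1.11. BSD is not proved by any of this.
-/

noncomputable section

open scoped Classical

-- the Theorems namespace of this sub repeats the summit name by design (D-0017 nested layout)
set_option linter.dupNamespace false
set_option autoImplicit false

open CategoryTheory Field NumberField IsDedekindDomain Function
open Literature.NumberTheory.EllipticCurves Literature.NumberTheory.GaloisCohomology
  Literature.NumberTheory.GaloisRepresentations
open Literature.NumberTheory.GaloisRepresentations.DiscreteGaloisModule (mu MuCarrier SelmerStructure unramifiedSubgroup
  localTatePairingZMod tateDual)
open _root_.WeierstrassCurve

namespace Summit.BirchSwinnertonDyer.BirchSwinnertonDyer.Theorems.CasselsTateLemma615OfPT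

/-! ## §1 `H³(K, μ_{p^r}) = 0` for an odd prime `p` over every number field -/

/-- **`H³(K, μ_{p^r}) = 0` for every number field `K` and every ODD prime `p`**: `cd_p(Γ_K) ≤ 2` for `p ≠ 2` (Serre II §4.4
Prop. 13, the tree's `fieldCdLE_two_of_numberField_holds`) applied to the `p`-primary torsion discrete module `μ_{p^r}`. In particular
the `Ш³(K, μ_n) = 0` input (Milne I 4.10(c)) of the Cassels–Tate recipe holds outright at every odd prime-power level.
[cite: SerreGaloisCohomology1997, II §4.4 Prop. 13] [cite: MilneADT2006, Ch. I, Thm. 4.10(c)] -/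
theorem galoisCohomology_three_mu_eq_zero_of_ne_two (K : Type) [Field K] [NumberField K] (p r : ℕ) [Fact p.Prime]
    (hp2 : p ≠ 2) [NeZero (p ^ r)] (x : galoisCohomology (mu K (p ^ r)) 3) : x = 0 := by
  have hcd : FieldCdLE K p 2 := fieldCdLE_two_of_numberField_holds K p (Or.inl hp2)
  have htors : IsPrimaryTorsion p (MuCarrier K (p ^ r)) :=
    IsPrimaryTorsion.of_forall_nsmul_eq_zero (r := r) fun v =>
      muVal_injective K (p ^ r) (by rw [muVal_nsmul, muVal_pow_eq_one, muVal_zero])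
  haveI : Subsingleton (galoisCohomology (mu K (p ^ r)) 3) :=
    hcd (MuCarrier K (p ^ r)) (mu K (p ^ r)) htors (by norm_num)
  exact Subsingleton.elim x 0

/-! ## §2 The levelwise Cassels–Tate fact for THE maps from `hPTc`, `hconj` and per-module Poitou–Tate only -/

section Assembly

/-- **`casselsTate_levelInputs K` from I 4.10(a) (cochain form), (v) and Poitou–Tate AT THE MODULES `E[p^{M₀}]` ONLY.** Take
`inv := LocalInvariants.canonical K (q·q)` (`q = p^{M₀}`, `p` odd): (i) reciprocity = `sumInvLocalizationEqZero_canonical_of_numberField`;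
(ii) local duality = `canonical_isPerfect`; (iii) `Ш³(K, μ_{q²}) = 0` = `galoisCohomology_three_mu_eq_zero_of_ne_two` (Serre II 4.4.13,
THEOREM); (iv) the level pairing via `isLevelPairing_ctLevelPairing_of_inputs` fed with the displayed `hPTc`, the Lemma-6.15 input
DISCHARGED by part 2 (`lemma615Input_canonical_of_selmerComplementAt`, `S₀ = ∅`) from the displayed per-module Howard (i) `hSC`, and
alternation `ctGeneralFun_self_eq_zero_of_odd`; (v) = the displayed `hconj`. CONDITIONAL on the three displayed hypotheses only.
[cite: MilneADT2006, Ch. I Cor. 2.3, Thm. 4.10(a)(b)(c), §6 Prop. 6.9, Thm. 6.13(a)(b), Lemma 6.15]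
[cite: SerreGaloisCohomology1997, II §4.4 Prop. 13] [cite: Howard2004HeegnerKolyvagin, Thm. 2.1.11] -/
theorem casselsTate_levelInputs_of_hPTc_of_hconj_of_selmerComplementAt (K : Type) [Field K] [NumberField K]
    (hPTc : ∀ (W : WeierstrassCurve ℚ) [W.IsElliptic] (p M₀ : ℕ), p.Prime → p ≠ 2 → 1 ≤ M₀ →
      ∀ [NeZero (p ^ M₀)]
        (e : geomTorsion (W.baseChange K) ((p ^ M₀ * p ^ M₀ : ℕ) : ℤ) →
          geomTorsion (W.baseChange K) ((p ^ M₀ * p ^ M₀ : ℕ) : ℤ) → AlgebraicClosure K)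
        (hμ : ∀ S T, e S T ^ (p ^ M₀ * p ^ M₀) = 1)
        (hadd₁ : ∀ S₁ S₂ T, e (S₁ + S₂) T = e S₁ T * e S₂ T)
        (hadd₂ : ∀ S T₁ T₂, e S (T₁ + T₂) = e S T₁ * e S T₂)
        (hgal : ∀ (σ : absoluteGaloisGroup K)
          (S T : geomTorsion (W.baseChange K) ((p ^ M₀ * p ^ M₀ : ℕ) : ℤ)), σ • e S T = e (σ • S) (σ • T)),
        (∀ T, e T T = 1) → (∀ T, (∀ S, e S T = 1) → T = 0) →
        ∀ f : contTwoCocycles ((W.baseChange K).torsionGaloisModule ((p ^ M₀ : ℕ) : ℤ)).toTopRep,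
          (∀ g : contOneCocycles ((W.baseChange K).torsionGaloisModule ((p ^ M₀ : ℕ) : ℤ)).toTopRep,
            (∀ v : Place K, locClass ((W.baseChange K).torsionGaloisModule ((p ^ M₀ : ℕ) : ℤ))
                (Place.Completion v)
                (resOne ((W.baseChange K).torsionGaloisModule ((p ^ M₀ : ℕ) : ℤ)) (Place.Completion v) g) = 0) →
            ∃ (C : PTChoice (W.baseChange K) (p ^ M₀) e hμ hadd₁ hadd₂ hgal f g) (S : Finset (Place K)),
              (∀ v ∉ S, C.localTerm (LocalInvariants.canonical K (p ^ M₀ * p ^ M₀)) v = 0) ∧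
                ∑ v ∈ S, C.localTerm (LocalInvariants.canonical K (p ^ M₀ * p ^ M₀)) v = 0) →
          twoCocycleClass _ f = 0)
    (hSC : ∀ (W : WeierstrassCurve ℚ) [W.IsElliptic] (p M₀ : ℕ), p.Prime → p ≠ 2 → 1 ≤ M₀ →
      ∀ [NeZero (p ^ M₀)] [Finite ((W.baseChange K).geomTorsion ((p ^ M₀ : ℕ) : ℤ))] (S : Finset (Place K)),
      (∀ v : HeightOneSpectrum (𝓞 K), (Sum.inr v : Place K) ∉ S →
        ((p ^ M₀ : ℕ) : 𝓞 K) ∉ v.asIdeal ∧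
          GaloisRep.IsUnramifiedAt v ((W.baseChange K).torsionGaloisModule ((p ^ M₀ : ℕ) : ℤ))) →
      ∀ (𝓕 𝓖 : SelmerStructure ((W.baseChange K).torsionGaloisModule ((p ^ M₀ : ℕ) : ℤ))), 𝓕 ≤ 𝓖 →
        𝓕.IsUnramifiedOutside S → 𝓖.IsUnramifiedOutside S →
        ∀ t : Π v : Place K, galoisCohomology (((W.baseChange K).torsionGaloisModule ((p ^ M₀ : ℕ) : ℤ)).toLocal v) 1,
          (∀ v ∈ S, t v ∈ 𝓖 v) →
          (∀ y ∈ ((LocalInvariants.canonical K (p ^ M₀)).dualSelmerStructure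
              ((W.baseChange K).torsionGaloisModule ((p ^ M₀ : ℕ) : ℤ)) 𝓕).selmerGroup,
            ∑ v ∈ S, localTatePairingZMod ((W.baseChange K).torsionGaloisModule ((p ^ M₀ : ℕ) : ℤ)) (p ^ M₀) v
              (LocalInvariants.canonical K (p ^ M₀) v) (t v)
              (galoisCohomology.localization
                (((W.baseChange K).torsionGaloisModule ((p ^ M₀ : ℕ) : ℤ)).tateDual (p ^ M₀)) v 1 y) = 0) →
          ∃ x ∈ 𝓖.selmerGroup, ∀ v ∈ S,
            galoisCohomology.localization ((W.baseChange K).torsionGaloisModule ((p ^ M₀ : ℕ) : ℤ)) v 1 x - t v ∈ 𝓕 v)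
    (hconj : ∀ (W : WeierstrassCurve ℚ) [W.IsElliptic] (p M₀ : ℕ), p.Prime → p ≠ 2 → 1 ≤ M₀ →
      ∀ [NeZero (p ^ M₀)] (c : K ≃ₐ[ℚ] K), c ≠ 1 → c * c = 1 →
      ∀ (e : geomTorsion (W.baseChange K) ((p ^ M₀ * p ^ M₀ : ℕ) : ℤ) →
          geomTorsion (W.baseChange K) ((p ^ M₀ * p ^ M₀ : ℕ) : ℤ) → AlgebraicClosure K)
        (hμ : ∀ S T, e S T ^ (p ^ M₀ * p ^ M₀) = 1)
        (hadd₁ : ∀ S₁ S₂ T, e (S₁ + S₂) T = e S₁ T * e S₂ T)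
        (hadd₂ : ∀ S T₁ T₂, e S (T₁ + T₂) = e S T₁ * e S T₂)
        (hgal : ∀ (σ : absoluteGaloisGroup K)
          (S T : geomTorsion (W.baseChange K) ((p ^ M₀ * p ^ M₀ : ℕ) : ℤ)), σ • e S T = e (σ • S) (σ • T)),
        (∀ T, e T T = 1) → (∀ T, (∀ S, e S T = 1) → T = 0) →
        ∀ z ∈ selmerGroup (W.baseChange K) ((p ^ M₀ * p ^ M₀ : ℕ) : ℤ),
          ∀ t ∈ selmerGroup (W.baseChange K) ((p ^ M₀ * p ^ M₀ : ℕ) : ℤ),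
          ctGeneralFun (W.baseChange K) (p ^ M₀) e hμ hadd₁ hadd₂ hgal
              (LocalInvariants.canonical K (p ^ M₀ * p ^ M₀))
              (torsionH1ToH1 (W.baseChange K) _ (conjAct W c _ z))
              (torsionH1ToH1 (W.baseChange K) _ (conjAct W c _ t)) =
            ctGeneralFun (W.baseChange K) (p ^ M₀) e hμ hadd₁ hadd₂ hgal
              (LocalInvariants.canonical K (p ^ M₀ * p ^ M₀))
              (torsionH1ToH1 (W.baseChange K) _ z) (torsionH1ToH1 (W.baseChange K) _ t)) :
    casselsTate_levelInputs K := by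
  intro W _ p M₀ hp hp2 hM₀ _ c hc hcc e hμ hadd₁ hadd₂ hgal halt hnd
  haveI : Fact p.Prime := ⟨hp⟩
  have hPT' : (LocalInvariants.canonical K (p ^ M₀ * p ^ M₀)).SumInvLocalizationEqZero :=
    sumInvLocalizationEqZero_canonical_of_numberField K _
  have hodd : Odd (p ^ M₀) := (hp.odd_of_ne_two hp2).pow
  -- (iii) `Ш³(K, μ_{q²}) = 0`: the whole `H³` vanishes (`p` odd)
  haveI : NeZero (p ^ (M₀ + M₀)) := ⟨pow_ne_zero _ hp.ne_zero⟩
  have hH3 : ∀ x : galoisCohomology (mu K (p ^ M₀ * p ^ M₀)) 3,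
      (∀ v : Place K, galoisCohomology.localization (mu K (p ^ M₀ * p ^ M₀)) v 3 x = 0) → x = 0 := by
    rw [← pow_add]
    exact fun x _ => galoisCohomology_three_mu_eq_zero_of_ne_two K p (M₀ + M₀) hp2 x
  -- the Lemma-6.15 input, discharged from `hSC` (part 2)
  haveI : Finite ((W.baseChange K).geomTorsion ((p ^ M₀ : ℕ) : ℤ)) := finite_geomTorsion_of_neZero (W.baseChange K) (p ^ M₀)
  have h615 : ∀ S : Finset (Place K), (∅ : Finset (Place K)) ⊆ S → ∀ x : LocalClasses (W.baseChange K) (p ^ M₀) S,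
      (∀ b' ∈ selmerGroup (W.baseChange K) ((p ^ M₀ : ℕ) : ℤ),
        sumPairing (W.baseChange K) (p ^ M₀) e hμ hadd₁ hadd₂ hgal
          (LocalInvariants.canonical K (p ^ M₀ * p ^ M₀)) S x (locS (W.baseChange K) (p ^ M₀) S b') = 0) →
      ∃ b₀ ∈ kummerOutside (W.baseChange K) (p ^ M₀) S, ∀ v : S,
        x v - locS (W.baseChange K) (p ^ M₀) S b₀ v ∈
          (W.baseChange K).kummerLocalConditionAt ((p ^ M₀ : ℕ) : ℤ) (Place.Completion (v : Place K)) :=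
    fun S _ x hx => lemma615Input_canonical_of_selmerComplementAt (W.baseChange K) p M₀ e hμ hadd₁ hadd₂ hgal halt hnd
      hp2 hM₀ (hSC W p M₀ hp hp2 hM₀) S x hx
  refine ⟨LocalInvariants.canonical K (p ^ M₀ * p ^ M₀), hPT', hH3, LocalInvariants.canonical_isPerfect, ?_,
    hconj W p M₀ hp hp2 hM₀ c hc hcc e hμ hadd₁ hadd₂ hgal halt hnd⟩
  exact isLevelPairing_ctLevelPairing_of_inputs (W.baseChange K) (p ^ M₀) e hμ hadd₁ hadd₂ hgal
    (LocalInvariants.canonical K (p ^ M₀ * p ^ M₀)) halt hPT' hH3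
    (hPTc W p M₀ hp hp2 hM₀ e hμ hadd₁ hadd₂ hgal halt hnd) ∅ h615
    (fun a ha hma ↦ ctGeneralFun_self_eq_zero_of_odd (LocalInvariants.canonical K (p ^ M₀ * p ^ M₀)) halt hPT'
      hH3 (localTerm_finite_support (W.baseChange K) (p ^ M₀) e hμ hadd₁ hadd₂ hgal halt _) hodd ha hma)

/-- **The same with the per-module input in Milne I 4.10(b) shape** (`Ker γ¹ ⊆ Im β¹` for `(W/K)[p^{M₀}]`, THE maps, every
finite `S ⊇ ∞` off which `p` and `E[p^{M₀}]` are unramified — the shape the Poitou–Tate lanes deliver per module): Howard (i) at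
the module is the tree's `PTAt.selmerComplementAt_canonical_of_middleExact` (koly3b g10).
[cite: MilneADT2006, Ch. I, Thm. 4.10(b), §6 Thm. 6.13(a)] [cite: Howard2004HeegnerKolyvagin, Thm. 2.1.11] -/
theorem casselsTate_levelInputs_of_hPTc_of_hconj_of_middleExactAt (K : Type) [Field K] [NumberField K]
    (hPTc : ∀ (W : WeierstrassCurve ℚ) [W.IsElliptic] (p M₀ : ℕ), p.Prime → p ≠ 2 → 1 ≤ M₀ →
      ∀ [NeZero (p ^ M₀)]
        (e : geomTorsion (W.baseChange K) ((p ^ M₀ * p ^ M₀ : ℕ) : ℤ) →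
          geomTorsion (W.baseChange K) ((p ^ M₀ * p ^ M₀ : ℕ) : ℤ) → AlgebraicClosure K)
        (hμ : ∀ S T, e S T ^ (p ^ M₀ * p ^ M₀) = 1)
        (hadd₁ : ∀ S₁ S₂ T, e (S₁ + S₂) T = e S₁ T * e S₂ T)
        (hadd₂ : ∀ S T₁ T₂, e S (T₁ + T₂) = e S T₁ * e S T₂)
        (hgal : ∀ (σ : absoluteGaloisGroup K)
          (S T : geomTorsion (W.baseChange K) ((p ^ M₀ * p ^ M₀ : ℕ) : ℤ)), σ • e S T = e (σ • S) (σ • T)),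
        (∀ T, e T T = 1) → (∀ T, (∀ S, e S T = 1) → T = 0) →
        ∀ f : contTwoCocycles ((W.baseChange K).torsionGaloisModule ((p ^ M₀ : ℕ) : ℤ)).toTopRep,
          (∀ g : contOneCocycles ((W.baseChange K).torsionGaloisModule ((p ^ M₀ : ℕ) : ℤ)).toTopRep,
            (∀ v : Place K, locClass ((W.baseChange K).torsionGaloisModule ((p ^ M₀ : ℕ) : ℤ))
                (Place.Completion v)
                (resOne ((W.baseChange K).torsionGaloisModule ((p ^ M₀ : ℕ) : ℤ)) (Place.Completion v) g) = 0) →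
            ∃ (C : PTChoice (W.baseChange K) (p ^ M₀) e hμ hadd₁ hadd₂ hgal f g) (S : Finset (Place K)),
              (∀ v ∉ S, C.localTerm (LocalInvariants.canonical K (p ^ M₀ * p ^ M₀)) v = 0) ∧
                ∑ v ∈ S, C.localTerm (LocalInvariants.canonical K (p ^ M₀ * p ^ M₀)) v = 0) →
          twoCocycleClass _ f = 0)
    (hE : ∀ (W : WeierstrassCurve ℚ) [W.IsElliptic] (p M₀ : ℕ), p.Prime → p ≠ 2 → 1 ≤ M₀ →
      ∀ [NeZero (p ^ M₀)] [Finite ((W.baseChange K).geomTorsion ((p ^ M₀ : ℕ) : ℤ))] (S : Finset (Place K)),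
      (∀ w : InfinitePlace K, (Sum.inl w : Place K) ∈ S) →
      (∀ v : HeightOneSpectrum (𝓞 K), (Sum.inr v : Place K) ∉ S →
        ((p ^ M₀ : ℕ) : 𝓞 K) ∉ v.asIdeal ∧
          GaloisRep.IsUnramifiedAt v ((W.baseChange K).torsionGaloisModule ((p ^ M₀ : ℕ) : ℤ))) →
      ∀ t : Π v : Place K, galoisCohomology (((W.baseChange K).torsionGaloisModule ((p ^ M₀ : ℕ) : ℤ)).toLocal v) 1,
        (∀ y : galoisCohomology (((W.baseChange K).torsionGaloisModule ((p ^ M₀ : ℕ) : ℤ)).tateDual (p ^ M₀)) 1,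
          (∀ v : HeightOneSpectrum (𝓞 K), (Sum.inr v : Place K) ∉ S →
            galoisCohomology.localization (((W.baseChange K).torsionGaloisModule ((p ^ M₀ : ℕ) : ℤ)).tateDual (p ^ M₀))
                (Sum.inr v) 1 y ∈
              unramifiedSubgroup (GaloisRep.toLocal v
                (((W.baseChange K).torsionGaloisModule ((p ^ M₀ : ℕ) : ℤ)).tateDual (p ^ M₀))) 1) →
          ∑ v ∈ S, localTatePairingZMod ((W.baseChange K).torsionGaloisModule ((p ^ M₀ : ℕ) : ℤ)) (p ^ M₀) v
            (LocalInvariants.canonical K (p ^ M₀) v) (t v)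
            (galoisCohomology.localization
              (((W.baseChange K).torsionGaloisModule ((p ^ M₀ : ℕ) : ℤ)).tateDual (p ^ M₀)) v 1 y) = 0) →
        ∃ x : galoisCohomology ((W.baseChange K).torsionGaloisModule ((p ^ M₀ : ℕ) : ℤ)) 1,
          (∀ v : HeightOneSpectrum (𝓞 K), (Sum.inr v : Place K) ∉ S →
            galoisCohomology.localization ((W.baseChange K).torsionGaloisModule ((p ^ M₀ : ℕ) : ℤ)) (Sum.inr v) 1 x ∈
              unramifiedSubgroup (GaloisRep.toLocal v ((W.baseChange K).torsionGaloisModule ((p ^ M₀ : ℕ) : ℤ))) 1) ∧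
          ∀ v ∈ S, galoisCohomology.localization ((W.baseChange K).torsionGaloisModule ((p ^ M₀ : ℕ) : ℤ)) v 1 x = t v)
    (hconj : ∀ (W : WeierstrassCurve ℚ) [W.IsElliptic] (p M₀ : ℕ), p.Prime → p ≠ 2 → 1 ≤ M₀ →
      ∀ [NeZero (p ^ M₀)] (c : K ≃ₐ[ℚ] K), c ≠ 1 → c * c = 1 →
      ∀ (e : geomTorsion (W.baseChange K) ((p ^ M₀ * p ^ M₀ : ℕ) : ℤ) →
          geomTorsion (W.baseChange K) ((p ^ M₀ * p ^ M₀ : ℕ) : ℤ) → AlgebraicClosure K)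
        (hμ : ∀ S T, e S T ^ (p ^ M₀ * p ^ M₀) = 1)
        (hadd₁ : ∀ S₁ S₂ T, e (S₁ + S₂) T = e S₁ T * e S₂ T)
        (hadd₂ : ∀ S T₁ T₂, e S (T₁ + T₂) = e S T₁ * e S T₂)
        (hgal : ∀ (σ : absoluteGaloisGroup K)
          (S T : geomTorsion (W.baseChange K) ((p ^ M₀ * p ^ M₀ : ℕ) : ℤ)), σ • e S T = e (σ • S) (σ • T)),
        (∀ T, e T T = 1) → (∀ T, (∀ S, e S T = 1) → T = 0) →
        ∀ z ∈ selmerGroup (W.baseChange K) ((p ^ M₀ * p ^ M₀ : ℕ) : ℤ),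
          ∀ t ∈ selmerGroup (W.baseChange K) ((p ^ M₀ * p ^ M₀ : ℕ) : ℤ),
          ctGeneralFun (W.baseChange K) (p ^ M₀) e hμ hadd₁ hadd₂ hgal
              (LocalInvariants.canonical K (p ^ M₀ * p ^ M₀))
              (torsionH1ToH1 (W.baseChange K) _ (conjAct W c _ z))
              (torsionH1ToH1 (W.baseChange K) _ (conjAct W c _ t)) =
            ctGeneralFun (W.baseChange K) (p ^ M₀) e hμ hadd₁ hadd₂ hgal
              (LocalInvariants.canonical K (p ^ M₀ * p ^ M₀))
              (torsionH1ToH1 (W.baseChange K) _ z) (torsionH1ToH1 (W.baseChange K) _ t)) :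
    casselsTate_levelInputs K := by
  refine casselsTate_levelInputs_of_hPTc_of_hconj_of_selmerComplementAt K hPTc
    (fun W _ p M₀ hp hp2 hM₀ _ _ S hS 𝓕 𝓖 hle h𝓕 h𝓖 => ?_) hconj
  have hM : ∀ P : (W.baseChange K).geomTorsion ((p ^ M₀ : ℕ) : ℤ), (p ^ M₀) • P = 0 := fun P => Subtype.ext (by
    have h := (mem_geomTorsion_iff (W.baseChange K) ((p ^ M₀ : ℕ) : ℤ) (P : geomPoints (W.baseChange K))).mp P.2
    rw [natCast_zsmul] at h
    exact h)
  exact (Summit.BirchSwinnertonDyer.Rank1Residual.X11b.Three.Koly.PTAt.selmerComplementAt_canonical_of_middleExact (p ^ M₀)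
    ⟨p, M₀, hp.prime, hM₀, rfl⟩ ((W.baseChange K).torsionGaloisModule ((p ^ M₀ : ℕ) : ℤ)) hM
    (fun S => hE W p M₀ hp hp2 hM₀ S) S hS 𝓕 𝓖 hle h𝓕 h𝓖).1

end Assembly

end Summit.BirchSwinnertonDyer.BirchSwinnertonDyer.Theorems.CasselsTateLemma615OfPT

end
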